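import Summits.ResolutionOfSingularities.ResolutionOfSingularities.Theorems.RadicialJungCleanModelsOfInputs
import Summits.ResolutionOfSingularities.ResolutionOfSingularities.Theorems.RadicialJungCleanModelsStubCossartPiltant2019OfLeavesClosed
import HarnessLib

/-!
# `CleanModels` from its registered inputs WITH STUB 2 REPLACED BY ITS LEAVES: {F-32, CP 2019 Thm. 1.5, `hEqT`, `hEqI`, Hironaka (char 0),
# F-112, wi-91399, (B), X44c, frontier}

OURS (decomp-res hand-1 g19; crux `stmt-ResolutionOfSingularities-15917`). A BOOKKEEPING composition of the lead's sorry-free packaging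
`OfInputs.cleanModels_of_inputs` (Sketch rev 33 shape; the rev-35 research stub is equivalent by `OfInputs.cleanLU3DefectNonDiscrete_rev34_of_rev33`)
with hand-1 g19's `cossartPiltant2019_of_stub1_of_equivariantLU_of_hironaka`: the PRINTED F-02 input `CossartPiltant2019.{0}` (CP 2019 Thm. 1.1,
XXL) is replaced by CP 2019 Thm. 1.5 (`CossartPiltant2019Local`, the local theorem — still XXL printed, but the part of Thm. 1.1 that is NOT
reduction/patching), the two research leaves `hEqT`, `hEqI` of the Prop. 4.10 climb (equivariant local uniformization, tame and inertia layers), and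
`Hironaka1964_local` (used only over fields of characteristic `0`, which the crux never meets — an artefact of F-02 being stated for all fields).

* `cleanModels_of_leaves` — `Theses.RadicialJung.CleanModels` from {F-32, CP Thm. 1.5, hEqT, hEqI, Hironaka1964_local, F-112, wi-91399, (B), X44c,
  frontier `dim ≥ 4`}.

A CONDITIONAL packaging (three research/frontier statements and two research leaves are hypotheses); it proves nothing about resolution in
characteristic `p`; rung 0. AI-written; AI review weaker than expert review.
-/

noncomputable section

set_option linter.dupNamespace false

open CategoryTheory AlgebraicGeometry IsLocalRing Polynomial
open Literature.AlgebraicGeometry.Resolution Literature.AlgebraicGeometry.Motives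
open Literature.AlgebraicGeometry.CossartPiltant200819

namespace Summit.ResolutionOfSingularities.ResolutionOfSingularities.Theorems.RadicialJung.CleanModels.OfInputs

/-- **`CleanModels` BY NAME from its inputs with F-02 replaced by its leaves** — `cleanModels_of_inputs` ∘
`cossartPiltant2019_of_stub1_of_equivariantLU_of_hironaka`. [cite: CossartPiltant2019, Thm. 1.1, Thm. 1.5, Props. 4.4, 4.6, 4.8, 4.10]
[cite: CossartJannsenSaito2020, Thm. 1.2, Thm. 1.4, Cor. 1.5] -/
theorem cleanModels_of_leaves
  -- PRINTED F-32: Cossart–Jannsen–Saito 2020 Thm. 1.4 (`B = ∅`). [cite: CossartJannsenSaito2020, Thm. 1.4]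
  (h32 : CossartJannsenSaito2020Embedded.{0})
  -- PRINTED: Cossart–Piltant 2019 Thm. 1.5 (the local theorem). [cite: CossartPiltant2019, Thm. 1.5]
  (hloc : CossartPiltant2019Local.{0})
  -- RESEARCH (OURS): equivariant local uniformization, tame layer (`hEqT`) and inertia layer (`hEqI`) of CP 2019 Prop. 4.10.
    (hEqT :
      ∀ (p : ℕ), p.Prime →
      ∀ (S : Type) [CommRing S] [IsDomain S] [IsRegularLocalRing S],
        IsExcellentRing S → ringKrullDim S = 3 → CharP (ResidueField S) p →
        IsAdicComplete (maximalIdeal S) S →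
      ∀ (E : Type) [Field E] [Algebra S E], Function.Injective (algebraMap S E) →
        IsAlgClosed E → Algebra.IsAlgebraic S E →
      ∀ (OE : ValuationSubring E), (∀ s : S, algebraMap S E s ∈ OE) →
        (∀ s ∈ maximalIdeal S, OE.valuation (algebraMap S E s) < 1) →
        (∀ y : OE, ∃ q : S[X], (∃ i, q.coeff i ∉ maximalIdeal S) ∧
          OE.valuation (q.eval₂ (algebraMap S E) y) < 1) →
      Nonempty OE.valuation.RankOne →
      ∀ (M' : Subfield E), (∀ s : S, algebraMap S E s ∈ M') →
      ∀ (H : Subgroup (E ≃ₐ[S] E)),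
        (∀ σ ∈ H, ∀ x ∈ M', σ x ∈ M') →
        (∀ σ ∈ H, ∀ x ∈ M', x ∈ OE → σ x ∈ OE) →
        (∀ σ ∈ H, ∀ x ∈ M', x ∈ OE → OE.valuation (σ x - x) < 1) →
        (∃ ℓ : ℕ, ℓ.Prime ∧ ℓ ≠ p ∧ ∀ σ ∈ H, ∀ x ∈ M', (σ ^ ℓ) x = x) →
        (∀ σ ∈ H, (∃ x ∈ M', σ x ≠ x) →
          ∃ x ∈ M', x ≠ 0 ∧ OE.valuation (σ x - x) = OE.valuation x) →
        (∃ t : Finset E, (t : Set E) ⊆ M' ∧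
          M' ≤ Subfield.closure (Set.range (algebraMap S E) ∪ (t : Set E)) ∧
          ∃ hTO : (Algebra.adjoin S (t : Set E)).toSubring ≤ OE.toSubring,
            IsRegularLocalRing (Localization.AtPrime
              (Ideal.comap (Subring.inclusion hTO) (maximalIdeal OE)))) →
        ∃ t : Finset E, (t : Set E) ⊆ M' ∧
          M' ≤ Subfield.closure (Set.range (algebraMap S E) ∪ (t : Set E)) ∧
          ∃ hTO : (Algebra.adjoin S (t : Set E)).toSubring ≤ OE.toSubring,
            IsRegularLocalRing (Localization.AtPrime
              (Ideal.comap (Subring.inclusion hTO) (maximalIdeal OE))) ∧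
            (∀ σ ∈ H, ∀ x ∈ locAtCentre (Algebra.adjoin S (t : Set E)).toSubring OE,
              σ x ∈ locAtCentre (Algebra.adjoin S (t : Set E)).toSubring OE))
    (hEqI :
      ∀ (p : ℕ), p.Prime →
      ∀ (S : Type) [CommRing S] [IsDomain S] [IsRegularLocalRing S],
        IsExcellentRing S → ringKrullDim S = 3 → CharP (ResidueField S) p →
        IsAdicComplete (maximalIdeal S) S →
      ∀ (E : Type) [Field E] [Algebra S E], Function.Injective (algebraMap S E) →
        IsAlgClosed E → Algebra.IsAlgebraic S E →
      ∀ (OE : ValuationSubring E), (∀ s : S, algebraMap S E s ∈ OE) →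
        (∀ s ∈ maximalIdeal S, OE.valuation (algebraMap S E s) < 1) →
        (∀ y : OE, ∃ q : S[X], (∃ i, q.coeff i ∉ maximalIdeal S) ∧
          OE.valuation (q.eval₂ (algebraMap S E) y) < 1) →
      Nonempty OE.valuation.RankOne →
      ∀ (M' : Subfield E), (∀ s : S, algebraMap S E s ∈ M') →
      ∀ (H : Subgroup (E ≃ₐ[S] E)),
        (∀ σ ∈ H, ∀ x ∈ M', σ x ∈ M') →
        (∀ σ ∈ H, ∀ x ∈ M', x ∈ OE → σ x ∈ OE) →
        (∀ σ ∈ H, (∃ x ∈ M', σ x ≠ x) →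
          ∃ x ∈ M', OE.valuation x = 1 ∧ OE.valuation (σ x - x) = 1) →
      ∀ (x₀ : E), x₀ ∈ M' → x₀ ∈ OE →
        (∃ t : Finset E, (t : Set E) ⊆ M' ∧
          M' ≤ Subfield.closure (Set.range (algebraMap S E) ∪ (t : Set E)) ∧
          ∃ hTO : (Algebra.adjoin S (t : Set E)).toSubring ≤ OE.toSubring,
            IsRegularLocalRing (Localization.AtPrime
              (Ideal.comap (Subring.inclusion hTO) (maximalIdeal OE)))) →
        ∃ t : Finset E, (t : Set E) ⊆ M' ∧
          M' ≤ Subfield.closure (Set.range (algebraMap S E) ∪ (t : Set E)) ∧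
          ∃ hTO : (Algebra.adjoin S (t : Set E)).toSubring ≤ OE.toSubring,
            IsRegularLocalRing (Localization.AtPrime
              (Ideal.comap (Subring.inclusion hTO) (maximalIdeal OE))) ∧
            (∀ σ ∈ H, ∀ x ∈ locAtCentre (Algebra.adjoin S (t : Set E)).toSubring OE,
              σ x ∈ locAtCentre (Algebra.adjoin S (t : Set E)).toSubring OE) ∧
            x₀ ∈ locAtCentre (Algebra.adjoin S (t : Set E)).toSubring OE)
  -- PRINTED: Hironaka 1964 / Temkin 2008 for quasi-excellent local rings of residue characteristic zero (used at char 0 only).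
  (hH : Hironaka1964_local.{0})
  -- PRINTED F-112: Cossart 1987 (`k = k̄`). [cite: Cossart1987, main theorem; Posva2024, App. A]
  (h112 : Cossart1987Thm)
  -- PRINTED wi-91399: Cossart–Piltant 2019 Thm. 1.5 (i), base-side `m = p` phase (every `p`; consumed at `p = 2`).
  (hBS : CossartPiltant2019_thm_1_5_i_baseSidePhase.{0})
  -- RESEARCH (OURS), class (B): `stub_cleanLU3DefectNonDiscrete` of Sketch rev 33, VERBATIM.
  (hB :
    ∀ (p : ℕ), p.Prime → p ≠ 2 →
    ∀ (k : Type) [Field k] [CharP k p] (K : Type) [Field K] [Algebra k K]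
    (O : ValuationSubring K) (A : Subalgebra k K), A.toSubring ≤ O.toSubring → A.FG → IsFractionRing A K →
    ringKrullDim A ≤ 3 → IsRegularLocalRing (locAtCentre A.toSubring O) →
    ringKrullDim (locAtCentre A.toSubring O) = 3 →
    (∀ (T : Subring K) (hT : T ≤ O.toSubring), A.toSubring ≤ T → (subringCentre T O hT).IsMaximal) →
    ∀ g₀ : K, (∀ c : K, c ^ p ≠ g₀) →
    (∀ f₀ : K, ∃ f₁ : K, O.valuation (g₀ - f₁ ^ p) < O.valuation (g₀ - f₀ ^ p)) →
    (∀ hk : ∀ c : k, algebraMap k K c ∈ O, transcendenceDefect k O hk ≠ 0) →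
    ¬ (∃ π : K, π ≠ 0 ∧ (∀ x : K, O.valuation x < 1 → O.valuation x ≤ O.valuation π) ∧
      (∀ x : K, x ≠ 0 → ∃ n : ℕ, O.valuation π ^ n ≤ O.valuation x)) →
    ¬ (∃ (O₁ : ValuationSubring K), O ≤ O₁ ∧ O₁ ≠ ⊤ ∧ ∃ y : Fin 2 → K, (∀ i, y i ∈ O) ∧
      ∀ P : MvPolynomial (Fin 2) k, P ≠ 0 → O₁.valuation (MvPolynomial.aeval y P) = 1) →
    ¬ (PerfectField k ∧ ∃ x y : K, x ≠ 0 ∧ y ≠ 0 ∧ ∀ a b : ℕ, a < p → b < p → (a ≠ 0 ∨ b ≠ 0) →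
      ∀ z : K, z ≠ 0 → O.valuation (x ^ a * y ^ b) ≠ O.valuation (z ^ p)) →
    ¬ ((∃ x y : K, x ≠ 0 ∧ y ≠ 0 ∧ ∀ a b : ℕ, a < p → b < p → (a ≠ 0 ∨ b ≠ 0) →
        ∀ z : K, z ≠ 0 → O.valuation (x ^ a * y ^ b) ≠ O.valuation (z ^ p)) ∧
      ∃ r : ℕ, Module.finrank (Subfield.closure (Set.range (fun x : k => x ^ p))) k = p ^ r ∧
        Module.finrank (Subfield.closure (Set.range (fun x : IsLocalRing.ResidueField O => x ^ p))) (IsLocalRing.ResidueField O) = p ^ r) →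
    ¬ ((∃ x y : K, x ≠ 0 ∧ y ≠ 0 ∧ ∀ a b : ℕ, a < p → b < p → (a ≠ 0 ∨ b ≠ 0) →
        ∀ z : K, z ≠ 0 → O.valuation (x ^ a * y ^ b) ≠ O.valuation (z ^ p)) ∧
      ∃ k' : IntermediateField k K, FiniteDimensional k k' ∧
        (∃ (n : ℕ) (s : Fin n → K), AlgebraicIndependent k' s ∧ Algebra.IsSeparable (IntermediateField.adjoin k' (Set.range s)) K) ∧
        ∃ _ : Algebra k' (IsLocalRing.ResidueField O),
          (∀ (c : k') (h : algebraMap k' K c ∈ O),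
            algebraMap k' (IsLocalRing.ResidueField O) c = IsLocalRing.residue O ⟨algebraMap k' K c, h⟩) ∧
          Algebra.IsSeparable k' (IsLocalRing.ResidueField O)) →
    ¬ IsAlgClosed k →
    ¬ (∃ O₁ : ValuationSubring K, O ≤ O₁ ∧ O₁ ≠ O ∧ O₁ ≠ ⊤) →
    ∃ (A' : Subalgebra k K), A'.toSubring ≤ O.toSubring ∧ A ≤ A' ∧ A'.FG ∧
    ∃ (_ : IsRegularLocalRing (locAtCentre A'.toSubring O)) (c : Fin p → K), (∃ j : Fin p, (j : ℕ) ≠ 0 ∧ c j ≠ 0) ∧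
    ((∃ (d m : ℕ) (hmd : m ≤ d) (t : Fin d → ↥(locAtCentre A'.toSubring O)) (a : Fin m → ℕ) (u : ↥(locAtCentre A'.toSubring O)), IsUnit u ∧
    Ideal.span (Set.range t) = IsLocalRing.maximalIdeal ↥(locAtCentre A'.toSubring O) ∧
    ringKrullDim ↥(locAtCentre A'.toSubring O) = (d : WithBot ℕ∞) ∧ 0 < m ∧ (∀ i, ¬ p ∣ a i) ∧
    (∑ j : Fin p, c j ^ p * g₀ ^ (j : ℕ)) = (u : K) * ∏ i : Fin m, ((t (Fin.castLE hmd i) : ↥(locAtCentre A'.toSubring O)) : K) ^ (a i)) ∨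
    (∃ u : ↥(locAtCentre A'.toSubring O), IsUnit u ∧ (∑ j : Fin p, c j ^ p * g₀ ^ (j : ℕ)) = (u : K) ∧
    ∀ c' : ↥(locAtCentre A'.toSubring O), u - c' ^ p ∉ IsLocalRing.maximalIdeal ↥(locAtCentre A'.toSubring O)) ∨
    (∃ s c' : ↥(locAtCentre A'.toSubring O), (∑ j : Fin p, c j ^ p * g₀ ^ (j : ℕ)) = (s : K) ∧
    s - c' ^ p ∈ IsLocalRing.maximalIdeal ↥(locAtCentre A'.toSubring O) ∧
    s - c' ^ p ∉ IsLocalRing.maximalIdeal ↥(locAtCentre A'.toSubring O) ^ 2)))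
  -- RESEARCH (OURS), X44c: `stub_cleanProp44` of Sketch rev 28–33, VERBATIM.
  (h44c :
    ∀ (p : ℕ), p.Prime → ∀ (S : Scheme.{0}) [IsIntegral S] [IsNoetherian S],
      CharP S.functionField p → Scheme.IsRegular S → Scheme.IsExcellent S → topologicalKrullDim S = 3 →
      ∀ G₀ : S.functionField, (∀ s : S, CleanRegAt p (algebraMap (S.presheaf.stalk s) S.functionField) G₀) →
      ∀ I : S.IdealSheafData, I ≠ ⊥ →
      ∀ (X : Scheme.{0}) (ρ : X ⟶ S) [IsIntegral X] [IsNoetherian X] [IsDominant ρ],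
        IsCleanRegularCentreBlowupSeq p ρ I G₀ →
        (∀ x : X, CleanRegAt p (algebraMap (X.presheaf.stalk x) X.functionField) (RatFn.functionFieldMap ρ G₀)) →
        ∀ (J : X.IdealSheafData) (μ : ℕ), 1 ≤ μ →
          (∀ x ∈ J.support, 1 < Order.coheight x) → (∀ x, idealOrder J x ≤ μ) → (∃ x, idealOrder J x = μ) →
          ∃ (X' : Scheme.{0}) (π : X' ⟶ X) (_ : IsIntegral X') (_ : IsDominant π) (J' : X'.IdealSheafData),
            IsCleanPermissibleSeq p π J μ J' (RatFn.functionFieldMap ρ G₀) ∧ ∀ x, idealOrder J' x < μ)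
  -- FRONTIER (rung-B PRICE): `stub_cleanModelsDimGEFour`, VERBATIM (`dim W ≥ 4`).
  (hGE4 :
      ∀ p : ℕ, p.Prime → ∀ (k : Type) [Field k] [CharP k p] (W : AlgebraicGeometry.Scheme.{0})
      [AlgebraicGeometry.IsIntegral W] (f : W ⟶ AlgebraicGeometry.Spec (.of k)) (L : Type) [Field L] [Algebra
      W.functionField L], AlgebraicGeometry.IsSeparated f → AlgebraicGeometry.LocallyOfFiniteType f →
      AlgebraicGeometry.QuasiCompact f → Literature.AlgebraicGeometry.Resolution.Scheme.IsRegular W →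
      IsPurelyInseparable W.functionField L → Module.finrank W.functionField L = p → ¬ topologicalKrullDim W ≤ 3 → ∃
      (V : AlgebraicGeometry.Scheme.{0}) (π : V ⟶ W) (_ : AlgebraicGeometry.IsIntegral V) (_ :
      AlgebraicGeometry.IsDominant π), AlgebraicGeometry.IsProper π ∧
      Literature.AlgebraicGeometry.Resolution.IsBirational π ∧
      Literature.AlgebraicGeometry.Resolution.Scheme.IsRegular V ∧ (∀ v : V, (∃ (y : L) (g : W.functionField), y ∉
      Set.range (algebraMap W.functionField L) ∧ algebraMap W.functionField L g = y ^ p ∧ ((∃ (d m : ℕ) (hmd : m ≤ d)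
      (t : Fin d → V.presheaf.stalk v) (a : Fin m → ℕ), Ideal.span (Set.range t) = IsLocalRing.maximalIdeal
      (V.presheaf.stalk v) ∧ ringKrullDim (V.presheaf.stalk v) = (d : WithBot ℕ∞) ∧ 0 < m ∧ (∀ i, ¬ p ∣ a i) ∧
      Literature.AlgebraicGeometry.Motives.RatFn.functionFieldMap π g = ∏ i : Fin m, (algebraMap (V.presheaf.stalk v)
      V.functionField (t (Fin.castLE hmd i))) ^ (a i)) ∨ (∃ u₀ : V.presheaf.stalk v, IsUnit u₀ ∧
      Literature.AlgebraicGeometry.Motives.RatFn.functionFieldMap π g = algebraMap (V.presheaf.stalk v)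
      V.functionField u₀ ∧ ((∀ c : V.presheaf.stalk v, u₀ - c ^ p ∉ IsLocalRing.maximalIdeal (V.presheaf.stalk v)) ∨
      (∃ c : V.presheaf.stalk v, u₀ - c ^ p ∈ IsLocalRing.maximalIdeal (V.presheaf.stalk v) ∧ u₀ - c ^ p ∉
      IsLocalRing.maximalIdeal (V.presheaf.stalk v) ^ 2))))))) :
    Summit.ResolutionOfSingularities.ResolutionOfSingularities.Theses.RadicialJung.CleanModels :=
  cleanModels_of_inputs h32
    (Summit.ResolutionOfSingularities.ResolutionOfSingularities.Theorems.RadicialJung.CleanModels.cossartPiltant2019_of_stub1_of_equivariantLU_of_hironaka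
      hloc h32 hEqT hEqI hH)
    h112 hBS hB h44c hGE4

end Summit.ResolutionOfSingularities.ResolutionOfSingularities.Theorems.RadicialJung.CleanModels.OfInputs

end
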